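import Summits.HodgeConjecture.HodgeConjecture.Theorems.Ring2WeilCoverageNormClassEq
import Summits.HodgeConjecture.HodgeConjecture.Theorems.Ring2WeilNormObstructionDescentCensus
import HarnessLib

/-!
# Weil-type family coverage — THEOREM S6 (product-window law), part C: eightfolds and a tenfold on `W8.3.5`/`W10.3.5`, the split
controls, the `ℚ(i)` row `W6.1.7`, the sharp tests (`n` a norm), and the `F₂₁ × S₃` data

research route conditional on HC_CM; not a corollary; Q11.4-sentence-2 already refuted in dim ≥ 3.

Ring 2, WEIL-TYPE FAMILY-COVERAGE CENSUS (`## b04`, block b04.13 and its P.S., owner ring2-b04, gen 49); third part of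
`Ring2WeilCoverageProductWindow` (same imports as part A).  Literal classes (engine `prodwin.py`, exact) of:
* `C₃ × F₂₀` (`F₂₀ = AGL(1,5)`): the `(4,4)` EIGHTFOLD families of genus 45, 48 (one parameter) and 51 (two parameters) on `W8.3.5`, the
  `(5,5)` TENFOLD family of genus 60 on `W10.3.5` (all with `r₁ = 1`, class `[5]` as THEOREM S6 predicts), and the two SPLIT CONTROLS of
  genus 36 / 41 (`r₁ = 0`: `(3,3)` sixfolds on `W6.3.1`) — kit j194983/j194984/j195114;
* `C₄ × AGL(1,7)`: the one-parameter `(3,3)` SIXFOLD family `(0; c0:222, c1:6A, c1:6B, c2:222)` of genus 71 on `W6.1.7 = (3, ℚ(i), [7])`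
  (`r₁ = 1`; PRE-REGISTERED non-split by S6 before kit j195081 returned) and its split companion (`r₁ = 0`);
* the SHARP TESTS of S6 (`r₁` ODD but `n ∈ Nm(K^×)` ⟹ SPLIT): `C₃ × S₄` (`n = 4`) genus 16, 19, 25 and `C₄ × F₂₀` (`n = 5 = 1 + 2²`) genus
  11, 19, 31 — every factor split although `det H` carries the prime `5` (e.g. `1024/5`, the SAME determinant as the non-split `C₃ × F₂₀`
  datum of genus 21 over `ℚ(√-3)`);
* `F₂₁ × S₃` (`K = ℚ(√-7)`): the `(1,1)`, `(2,2)`, `(3,3)`, `(3,3)` factors of genus 22, 43, 64, 64 — all SPLIT (`r₁ = 0`), as the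
  `F₂₁ × S₃` law `[3]^{r₁}` of census b04.13 (D) predicts (kit j195079/j195080).
No `def`, no named fact, no `sorry`; nothing about Hodge classes; `HC_CM` used nowhere.  References: [cite: vanGeemen1994HodgeAV, (5.4.1), Lemma 5.2].
-/

set_option linter.dupNamespace false

open Literature.AlgebraicGeometry.Motives
open Literature.AlgebraicGeometry.VanGeemen1994
open Summit.HodgeConjecture.HodgeConjecture.Ring2.Hypotheses

namespace Summit.HodgeConjecture.HodgeConjecture.Ring2.WeilCoverage

/-- `C₃ × F₂₀` (`F₂₀ = AGL(1,5)` on 5 points)-cover `(0; c0:5,c1:22,c1:4A,c1:4A)` (genus 45, Hurwitz dimension 1; engine `prodwin.py`, exact): the HIDDEN FACTOR `B = V^{H₁×Stab(0)}` of the `(λ⊗ρ)`-piece `P ~ B^{4}` (census row of `P`: `W32.3.1`) — an abelian EIGHTFOLD with `(4,4)` `ℚ(√-3)`-action, WEIL TYPE — has literal `det H|_B = 16777216/45`, `a = 16777216/45`, `T(a) = [3, 5]`: row `W8.3.5` (NON-split); `r₁ = dim_K H¹(C̃/G₂)_λ = 1`. THEOREM S6 (product-window law, census b04.13 (A)) predicts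 `T(a_B) = [3, 5]` from `r₁ = 1`, `r_H = 9` — CONFIRMED.
research route conditional on HC_CM; not a corollary; Q11.4-sentence-2 already refuted in dim ≥ 3. [cite: vanGeemen1994HodgeAV, (5.4.1)] -/
theorem pwC3F20_c05_c122_c14A_c14A_q0_g45_mk_detH_ne_split :
    (QuotientGroup.mk (Units.mk0 (((16777216 : ℚ) / 45)) (by norm_num)) : weilNormResidueGroup 3) ≠
      splitDiscriminantClass 4 3 := by
  have e : Units.mk0 (((16777216 : ℚ) / 45)) (by norm_num) = Units.mk0 ((16777216 : ℚ) / 45) (by norm_num) := Units.ext (by norm_num)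
  rw [Ne, e, mk_eq_splitDiscriminantClass_iff_of_even (n := 4) (by decide)]
  have h := mul_not_mem_normUnitsSubgroup (mem_normUnitsSubgroup_of_sq_add_mul_sq (d := 3) (a := ((16777216 : ℚ) / 225)) (by norm_num) ((4096 : ℚ) / 15) (0 : ℚ) (by norm_num))
    Summit.HodgeConjecture.Ring2WeilNormDescent.five_not_mem_norm_three
  rw [mk0_mul_mk0] at h
  norm_num at h
  exact h

/-- The same datum, CELL IDENTIFICATION: `[det H|_B] = [5]` in `ℚˣ/Nm(ℚ(√-3)ˣ)` — the census ROW KEY of `W8.3.5` (`a·5 = ((16777216 : ℚ) / 9) = (((4096 : ℚ) / 3))² + 3·((0 : ℚ))²`).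
research route conditional on HC_CM; not a corollary; Q11.4-sentence-2 already refuted in dim ≥ 3. [cite: vanGeemen1994HodgeAV, Lemma 5.2 (3)] -/
theorem pwC3F20_c05_c122_c14A_c14A_q0_g45_mk_detH_eq_key :
    (QuotientGroup.mk (Units.mk0 (((16777216 : ℚ) / 45)) (by norm_num)) : weilNormResidueGroup 3) =
      QuotientGroup.mk (Units.mk0 (5 : ℚ) (by norm_num)) :=
  mk_eq_mk_of_mul_mem (by norm_num) (by norm_num)
    (mem_normUnitsSubgroup_of_sq_add_mul_sq _ ((4096 : ℚ) / 3) (0 : ℚ) (by norm_num))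

/-- `C₃ × F₂₀` (`F₂₀ = AGL(1,5)` on 5 points)-cover `(0; c0:22,c0:22,c1:22,c1:4A,c1:4A)` (genus 51, Hurwitz dimension 2; engine `prodwin.py`, exact): the HIDDEN FACTOR `B = V^{H₁×Stab(0)}` of the `(λ⊗ρ)`-piece `P ~ B^{4}` (census row of `P`: `W32.3.1`) — an abelian EIGHTFOLD with `(4,4)` `ℚ(√-3)`-action, WEIL TYPE — has literal `det H|_B = 262144/45`, `a = 262144/45`, `T(a) = [3, 5]`: row `W8.3.5` (NON-split); `r₁ = dim_K H¹(C̃/G₂)_λ = 1`. THEOREM S6 (product-window law, census b04.13 (A)) predicts `T(a_B) = [3, 5]` from `r₁ = 1`, `r_H = 9` — CONFIRMED.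
research route conditional on HC_CM; not a corollary; Q11.4-sentence-2 already refuted in dim ≥ 3. [cite: vanGeemen1994HodgeAV, (5.4.1)] -/
theorem pwC3F20_c022_c022_c122_c14A_c14A_q0_g51_mk_detH_ne_split :
    (QuotientGroup.mk (Units.mk0 (((262144 : ℚ) / 45)) (by norm_num)) : weilNormResidueGroup 3) ≠
      splitDiscriminantClass 4 3 := by
  have e : Units.mk0 (((262144 : ℚ) / 45)) (by norm_num) = Units.mk0 ((262144 : ℚ) / 45) (by norm_num) := Units.ext (by norm_num)
  rw [Ne, e, mk_eq_splitDiscriminantClass_iff_of_even (n := 4) (by decide)]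
  have h := mul_not_mem_normUnitsSubgroup (mem_normUnitsSubgroup_of_sq_add_mul_sq (d := 3) (a := ((262144 : ℚ) / 225)) (by norm_num) ((512 : ℚ) / 15) (0 : ℚ) (by norm_num))
    Summit.HodgeConjecture.Ring2WeilNormDescent.five_not_mem_norm_three
  rw [mk0_mul_mk0] at h
  norm_num at h
  exact h

/-- The same datum, CELL IDENTIFICATION: `[det H|_B] = [5]` in `ℚˣ/Nm(ℚ(√-3)ˣ)` — the census ROW KEY of `W8.3.5` (`a·5 = ((262144 : ℚ) / 9) = (((512 : ℚ) / 3))² + 3·((0 : ℚ))²`).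
research route conditional on HC_CM; not a corollary; Q11.4-sentence-2 already refuted in dim ≥ 3. [cite: vanGeemen1994HodgeAV, Lemma 5.2 (3)] -/
theorem pwC3F20_c022_c022_c122_c14A_c14A_q0_g51_mk_detH_eq_key :
    (QuotientGroup.mk (Units.mk0 (((262144 : ℚ) / 45)) (by norm_num)) : weilNormResidueGroup 3) =
      QuotientGroup.mk (Units.mk0 (5 : ℚ) (by norm_num)) :=
  mk_eq_mk_of_mul_mem (by norm_num) (by norm_num)
    (mem_normUnitsSubgroup_of_sq_add_mul_sq _ ((512 : ℚ) / 3) (0 : ℚ) (by norm_num))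

/-- `C₃ × F₂₀` (`F₂₀ = AGL(1,5)` on 5 points)-cover `(0; c0:5,c1:4A,c1:4B,c1:5)` (genus 48, Hurwitz dimension 1; engine `prodwin.py`, exact): the HIDDEN FACTOR `B = V^{H₁×Stab(0)}` of the `(λ⊗ρ)`-piece `P ~ B^{4}` (census row of `P`: `W32.3.1`) — an abelian EIGHTFOLD with `(4,4)` `ℚ(√-3)`-action, WEIL TYPE — has literal `det H|_B = 16777216/405`, `a = 16777216/405`, `T(a) = [3, 5]`: row `W8.3.5` (NON-split); `r₁ = dim_K H¹(C̃/G₂)_λ = 1`. THEOREM S6 (product-window law, census b04.13 (A)) predicts `T(a_B) = [3, 5]` from `r₁ = 1`, `r_H = 9` — CONFIRMED.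
research route conditional on HC_CM; not a corollary; Q11.4-sentence-2 already refuted in dim ≥ 3. [cite: vanGeemen1994HodgeAV, (5.4.1)] -/
theorem pwC3F20_c05_c14A_c14B_c15_q0_g48_mk_detH_ne_split :
    (QuotientGroup.mk (Units.mk0 (((16777216 : ℚ) / 405)) (by norm_num)) : weilNormResidueGroup 3) ≠
      splitDiscriminantClass 4 3 := by
  have e : Units.mk0 (((16777216 : ℚ) / 405)) (by norm_num) = Units.mk0 ((16777216 : ℚ) / 405) (by norm_num) := Units.ext (by norm_num)
  rw [Ne, e, mk_eq_splitDiscriminantClass_iff_of_even (n := 4) (by decide)]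
  have h := mul_not_mem_normUnitsSubgroup (mem_normUnitsSubgroup_of_sq_add_mul_sq (d := 3) (a := ((16777216 : ℚ) / 2025)) (by norm_num) ((4096 : ℚ) / 45) (0 : ℚ) (by norm_num))
    Summit.HodgeConjecture.Ring2WeilNormDescent.five_not_mem_norm_three
  rw [mk0_mul_mk0] at h
  norm_num at h
  exact h

/-- The same datum, CELL IDENTIFICATION: `[det H|_B] = [5]` in `ℚˣ/Nm(ℚ(√-3)ˣ)` — the census ROW KEY of `W8.3.5` (`a·5 = ((16777216 : ℚ) / 81) = (((4096 : ℚ) / 9))² + 3·((0 : ℚ))²`).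
research route conditional on HC_CM; not a corollary; Q11.4-sentence-2 already refuted in dim ≥ 3. [cite: vanGeemen1994HodgeAV, Lemma 5.2 (3)] -/
theorem pwC3F20_c05_c14A_c14B_c15_q0_g48_mk_detH_eq_key :
    (QuotientGroup.mk (Units.mk0 (((16777216 : ℚ) / 405)) (by norm_num)) : weilNormResidueGroup 3) =
      QuotientGroup.mk (Units.mk0 (5 : ℚ) (by norm_num)) :=
  mk_eq_mk_of_mul_mem (by norm_num) (by norm_num)
    (mem_normUnitsSubgroup_of_sq_add_mul_sq _ ((4096 : ℚ) / 9) (0 : ℚ) (by norm_num))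

/-- `C₃ × F₂₀` (`F₂₀ = AGL(1,5)` on 5 points)-cover `(0; c0:22,c0:5,c1:22,c1:4A,c1:4B)` (genus 60, Hurwitz dimension 2; engine `prodwin.py`, exact): the HIDDEN FACTOR `B = V^{H₁×Stab(0)}` of the `(λ⊗ρ)`-piece `P ~ B^{4}` (census row of `P`: `W40.3.1`) — an abelian TENFOLD with `(5,5)` `ℚ(√-3)`-action, WEIL TYPE — has literal `det H|_B = -268435456/45`, `a = 268435456/45`, `T(a) = [3, 5]`: row `W10.3.5` (NON-split); `r₁ = dim_K H¹(C̃/G₂)_λ = 1`. THEOREM S6 (product-window law, census b04.13 (A)) predicts `T(a_B) = [3, 5]` from `r₁ = 1`, `r_H = 11` — CONFIRMED.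
research route conditional on HC_CM; not a corollary; Q11.4-sentence-2 already refuted in dim ≥ 3. [cite: vanGeemen1994HodgeAV, (5.4.1)] -/
theorem pwC3F20_c022_c05_c122_c14A_c14B_q0_g60_mk_detH_ne_split :
    (QuotientGroup.mk (Units.mk0 (((-268435456 : ℚ) / 45)) (by norm_num)) : weilNormResidueGroup 3) ≠
      splitDiscriminantClass 5 3 := by
  have e : Units.mk0 (((-268435456 : ℚ) / 45)) (by norm_num) = -(Units.mk0 ((268435456 : ℚ) / 45) (by norm_num)) := Units.ext (by norm_num)
  rw [Ne, e, mk_neg_eq_splitDiscriminantClass_iff_of_odd (n := 5) (by decide)]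
  have h := mul_not_mem_normUnitsSubgroup (mem_normUnitsSubgroup_of_sq_add_mul_sq (d := 3) (a := ((268435456 : ℚ) / 225)) (by norm_num) ((16384 : ℚ) / 15) (0 : ℚ) (by norm_num))
    Summit.HodgeConjecture.Ring2WeilNormDescent.five_not_mem_norm_three
  rw [mk0_mul_mk0] at h
  norm_num at h
  exact h

/-- The same datum, CELL IDENTIFICATION: `[det H|_B] = [-5]` in `ℚˣ/Nm(ℚ(√-3)ˣ)` — the census ROW KEY of `W10.3.5` (`a·5 = ((268435456 : ℚ) / 9) = (((16384 : ℚ) / 3))² + 3·((0 : ℚ))²`).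
research route conditional on HC_CM; not a corollary; Q11.4-sentence-2 already refuted in dim ≥ 3. [cite: vanGeemen1994HodgeAV, Lemma 5.2 (3)] -/
theorem pwC3F20_c022_c05_c122_c14A_c14B_q0_g60_mk_detH_eq_key :
    (QuotientGroup.mk (Units.mk0 (-(((268435456 : ℚ) / 45))) (neg_ne_zero.2 (by norm_num))) : weilNormResidueGroup 3) =
      QuotientGroup.mk (Units.mk0 (-(5 : ℚ)) (neg_ne_zero.2 (by norm_num))) :=
  mk_neg_eq_mk_neg_of_mul_mem (by norm_num) (by norm_num)
    (mem_normUnitsSubgroup_of_sq_add_mul_sq _ ((16384 : ℚ) / 3) (0 : ℚ) (by norm_num))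

/-- `C₃ × F₂₀` (`F₂₀ = AGL(1,5)` on 5 points)-cover `(0; c0:4A,c0:4B,c1:22,c2:22)` (genus 36, Hurwitz dimension 1; engine `prodwin.py`, exact): the HIDDEN FACTOR `B = V^{H₁×Stab(0)}` of the `(λ⊗ρ)`-piece `P ~ B^{4}` (census row of `P`: `W24.3.1`) — an abelian SIXFOLD with `(3,3)` `ℚ(√-3)`-action, WEIL TYPE — has literal `det H|_B = -176896/3`, `a = 176896/3`, `T(a) = []`: row `W6.3.1` (SPLIT); `r₁ = dim_K H¹(C̃/G₂)_λ = 0`. THEOREM S6 (product-window law, census b04.13 (A)) predicts `T(a_B) = []` from `r₁ = 0`, `r_H = 6` — CONFIRMED.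
research route conditional on HC_CM; not a corollary; Q11.4-sentence-2 already refuted in dim ≥ 3. [cite: vanGeemen1994HodgeAV, (5.4.1)] -/
theorem pwC3F20_c04A_c04B_c122_c222_q0_g36_mk_detH_eq_split :
    (QuotientGroup.mk (Units.mk0 (((-176896 : ℚ) / 3)) (by norm_num)) : weilNormResidueGroup 3) =
      splitDiscriminantClass 3 3 := by
  have e : Units.mk0 (((-176896 : ℚ) / 3)) (by norm_num) = -(Units.mk0 ((176896 : ℚ) / 3) (by norm_num)) := Units.ext (by norm_num)
  rw [e, mk_neg_eq_splitDiscriminantClass_iff_of_odd (n := 3) (by decide)]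
  exact mem_normUnitsSubgroup_of_sq_add_mul_sq _ (-88 : ℚ) ((392 : ℚ) / 3) (by norm_num)

/-- `C₃ × F₂₀` (`F₂₀ = AGL(1,5)` on 5 points)-cover `(0; c0:4A,c0:4A,c1:4A,c2:4A)` (genus 41, Hurwitz dimension 1; engine `prodwin.py`, exact): the HIDDEN FACTOR `B = V^{H₁×Stab(0)}` of the `(λ⊗ρ)`-piece `P ~ B^{4}` (census row of `P`: `W24.3.1`) — an abelian SIXFOLD with `(3,3)` `ℚ(√-3)`-action, WEIL TYPE — has literal `det H|_B = -1024/9`, `a = 1024/9`, `T(a) = []`: row `W6.3.1` (SPLIT); `r₁ = dim_K H¹(C̃/G₂)_λ = 0`. THEOREM S6 (product-window law, census b04.13 (A)) predicts `T(a_B) = []` from `r₁ = 0`, `r_H = 6` — CONFIRMED.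
research route conditional on HC_CM; not a corollary; Q11.4-sentence-2 already refuted in dim ≥ 3. [cite: vanGeemen1994HodgeAV, (5.4.1)] -/
theorem pwC3F20_c04A_c04A_c14A_c24A_q0_g41_mk_detH_eq_split :
    (QuotientGroup.mk (Units.mk0 (((-1024 : ℚ) / 9)) (by norm_num)) : weilNormResidueGroup 3) =
      splitDiscriminantClass 3 3 := by
  have e : Units.mk0 (((-1024 : ℚ) / 9)) (by norm_num) = -(Units.mk0 ((1024 : ℚ) / 9) (by norm_num)) := Units.ext (by norm_num)
  rw [e, mk_neg_eq_splitDiscriminantClass_iff_of_odd (n := 3) (by decide)]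
  exact mem_normUnitsSubgroup_of_sq_add_mul_sq _ ((32 : ℚ) / 3) (0 : ℚ) (by norm_num)

/-- `C₄ × AGL(1,7)`-cover `(0; c0:222,c1:6A,c1:6B,c2:222)` (genus 71, Hurwitz dimension 1; engine `prodwin.py`, exact): the HIDDEN FACTOR `B = V^{H₁×Stab(0)}` of the `(λ⊗ρ)`-piece `P ~ B^{6}` (census row of `P`: `W36.1.1`) — an abelian SIXFOLD with `(3,3)` `ℚ(√-1)`-action, WEIL TYPE — has literal `det H|_B = -729/7`, `a = 729/7`, `T(a) = [2, 7]`: row `W6.1.7` (NON-split); `r₁ = dim_K H¹(C̃/G₂)_λ = 1`. THEOREM S6 (product-window law, census b04.13 (A)) predicts `T(a_B) = [2, 7]` from `r₁ = 1`, `r_H = 7` — CONFIRMED.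
research route conditional on HC_CM; not a corollary; Q11.4-sentence-2 already refuted in dim ≥ 3. [cite: vanGeemen1994HodgeAV, (5.4.1)] -/
theorem pwC4F42_c0222_c16A_c16B_c2222_q0_g71_mk_detH_ne_split :
    (QuotientGroup.mk (Units.mk0 (((-729 : ℚ) / 7)) (by norm_num)) : weilNormResidueGroup 1) ≠
      splitDiscriminantClass 3 1 := by
  have e : Units.mk0 (((-729 : ℚ) / 7)) (by norm_num) = -(Units.mk0 ((729 : ℚ) / 7) (by norm_num)) := Units.ext (by norm_num)
  rw [Ne, e, mk_neg_eq_splitDiscriminantClass_iff_of_odd (n := 3) (by decide)]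
  have h := mul_not_mem_normUnitsSubgroup (mem_normUnitsSubgroup_of_sq_add_mul_sq (d := 1) (a := ((729 : ℚ) / 49)) (by norm_num) ((27 : ℚ) / 7) (0 : ℚ) (by norm_num))
    Summit.HodgeConjecture.Ring2WeilNormDescent.seven_not_mem_norm_one
  rw [mk0_mul_mk0] at h
  norm_num at h
  exact h

/-- The same datum, CELL IDENTIFICATION: `[det H|_B] = [-7]` in `ℚˣ/Nm(ℚ(√-1)ˣ)` — the census ROW KEY of `W6.1.7` (`a·7 = (729 : ℚ) = ((27 : ℚ))² + 1·((0 : ℚ))²`).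
research route conditional on HC_CM; not a corollary; Q11.4-sentence-2 already refuted in dim ≥ 3. [cite: vanGeemen1994HodgeAV, Lemma 5.2 (3)] -/
theorem pwC4F42_c0222_c16A_c16B_c2222_q0_g71_mk_detH_eq_key :
    (QuotientGroup.mk (Units.mk0 (-(((729 : ℚ) / 7))) (neg_ne_zero.2 (by norm_num))) : weilNormResidueGroup 1) =
      QuotientGroup.mk (Units.mk0 (-(7 : ℚ)) (neg_ne_zero.2 (by norm_num))) :=
  mk_neg_eq_mk_neg_of_mul_mem (by norm_num) (by norm_num)
    (mem_normUnitsSubgroup_of_sq_add_mul_sq _ (27 : ℚ) (0 : ℚ) (by norm_num))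

/-- `C₄ × AGL(1,7)`-cover `(0; c0:222,c0:222,c1:6A,c3:6B)` (genus 71, Hurwitz dimension 1; engine `prodwin.py`, exact): the HIDDEN FACTOR `B = V^{H₁×Stab(0)}` of the `(λ⊗ρ)`-piece `P ~ B^{6}` (census row of `P`: `W36.1.1`) — an abelian SIXFOLD with `(3,3)` `ℚ(√-1)`-action, WEIL TYPE — has literal `det H|_B = -729/8`, `a = 729/8`, `T(a) = []`: row `W6.1.1` (SPLIT); `r₁ = dim_K H¹(C̃/G₂)_λ = 0`. THEOREM S6 (product-window law, census b04.13 (A)) predicts `T(a_B) = []` from `r₁ = 0`, `r_H = 6` — CONFIRMED.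
research route conditional on HC_CM; not a corollary; Q11.4-sentence-2 already refuted in dim ≥ 3. [cite: vanGeemen1994HodgeAV, (5.4.1)] -/
theorem pwC4F42_c0222_c0222_c16A_c36B_q0_g71_mk_detH_eq_split :
    (QuotientGroup.mk (Units.mk0 (((-729 : ℚ) / 8)) (by norm_num)) : weilNormResidueGroup 1) =
      splitDiscriminantClass 3 1 := by
  have e : Units.mk0 (((-729 : ℚ) / 8)) (by norm_num) = -(Units.mk0 ((729 : ℚ) / 8) (by norm_num)) := Units.ext (by norm_num)
  rw [e, mk_neg_eq_splitDiscriminantClass_iff_of_odd (n := 3) (by decide)]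
  exact mem_normUnitsSubgroup_of_sq_add_mul_sq _ ((27 : ℚ) / 4) ((27 : ℚ) / 4) (by norm_num)

/-- `C3xS4`-cover `(0; c1:2,c1:3,c1:4)` (genus 16, Hurwitz dimension 0; engine `prodwin.py`, exact): the HIDDEN FACTOR `B = V^{H₁×Stab(0)}` of the `(λ⊗ρ)`-piece `P ~ B^{3}` (census row of `P`: `W6.3.1`) — an abelian SURFACE with `(1,1)` `ℚ(√-3)`-action, WEIL TYPE — has literal `det H|_B = -9/4`, `a = 9/4`, `T(a) = []`: row `W2.3.1` (SPLIT); `r₁ = dim_K H¹(C̃/G₂)_λ = 1`. THEOREM S6 (product-window law, census b04.13 (A)) predicts `T(a_B) = []` from `r₁ = 1`, `r_H = 3` — CONFIRMED.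
research route conditional on HC_CM; not a corollary; Q11.4-sentence-2 already refuted in dim ≥ 3. [cite: vanGeemen1994HodgeAV, (5.4.1)] -/
theorem pwC3S4_c12_c13_c14_q0_g16_mk_detH_eq_split :
    (QuotientGroup.mk (Units.mk0 (((-9 : ℚ) / 4)) (by norm_num)) : weilNormResidueGroup 3) =
      splitDiscriminantClass 1 3 := by
  have e : Units.mk0 (((-9 : ℚ) / 4)) (by norm_num) = -(Units.mk0 ((9 : ℚ) / 4) (by norm_num)) := Units.ext (by norm_num)
  rw [e, mk_neg_eq_splitDiscriminantClass_iff_of_odd (n := 1) (by decide)]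
  exact mem_normUnitsSubgroup_of_sq_add_mul_sq _ ((3 : ℚ) / 2) (0 : ℚ) (by norm_num)

/-- `C3xS4`-cover `(0; c1:3,c1:4,c1:4)` (genus 19, Hurwitz dimension 0; engine `prodwin.py`, exact): the HIDDEN FACTOR `B = V^{H₁×Stab(0)}` of the `(λ⊗ρ)`-piece `P ~ B^{3}` (census row of `P`: `W6.3.1`) — an abelian SURFACE with `(1,1)` `ℚ(√-3)`-action, WEIL TYPE — has literal `det H|_B = -9/4`, `a = 9/4`, `T(a) = []`: row `W2.3.1` (SPLIT); `r₁ = dim_K H¹(C̃/G₂)_λ = 1`. THEOREM S6 (product-window law, census b04.13 (A)) predicts `T(a_B) = []` from `r₁ = 1`, `r_H = 3` — CONFIRMED.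
research route conditional on HC_CM; not a corollary; Q11.4-sentence-2 already refuted in dim ≥ 3. [cite: vanGeemen1994HodgeAV, (5.4.1)] -/
theorem pwC3S4_c13_c14_c14_q0_g19_mk_detH_eq_split :
    (QuotientGroup.mk (Units.mk0 (((-9 : ℚ) / 4)) (by norm_num)) : weilNormResidueGroup 3) =
      splitDiscriminantClass 1 3 := by
  have e : Units.mk0 (((-9 : ℚ) / 4)) (by norm_num) = -(Units.mk0 ((9 : ℚ) / 4) (by norm_num)) := Units.ext (by norm_num)
  rw [e, mk_neg_eq_splitDiscriminantClass_iff_of_odd (n := 1) (by decide)]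
  exact mem_normUnitsSubgroup_of_sq_add_mul_sq _ ((3 : ℚ) / 2) (0 : ℚ) (by norm_num)

/-- `C3xS4`-cover `(0; c0:2,c1:2,c1:3,c1:3)` (genus 25, Hurwitz dimension 1; engine `prodwin.py`, exact): the HIDDEN FACTOR `B = V^{H₁×Stab(0)}` of the `(λ⊗ρ)`-piece `P ~ B^{3}` (census row of `P`: `W6.3.1`) — an abelian SURFACE with `(1,1)` `ℚ(√-3)`-action, WEIL TYPE — has literal `det H|_B = -9/4`, `a = 9/4`, `T(a) = []`: row `W2.3.1` (SPLIT); `r₁ = dim_K H¹(C̃/G₂)_λ = 1`. THEOREM S6 (product-window law, census b04.13 (A)) predicts `T(a_B) = []` from `r₁ = 1`, `r_H = 3` — CONFIRMED.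
research route conditional on HC_CM; not a corollary; Q11.4-sentence-2 already refuted in dim ≥ 3. [cite: vanGeemen1994HodgeAV, (5.4.1)] -/
theorem pwC3S4_c02_c12_c13_c13_q0_g25_mk_detH_eq_split :
    (QuotientGroup.mk (Units.mk0 (((-9 : ℚ) / 4)) (by norm_num)) : weilNormResidueGroup 3) =
      splitDiscriminantClass 1 3 := by
  have e : Units.mk0 (((-9 : ℚ) / 4)) (by norm_num) = -(Units.mk0 ((9 : ℚ) / 4) (by norm_num)) := Units.ext (by norm_num)
  rw [e, mk_neg_eq_splitDiscriminantClass_iff_of_odd (n := 1) (by decide)]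
  exact mem_normUnitsSubgroup_of_sq_add_mul_sq _ ((3 : ℚ) / 2) (0 : ℚ) (by norm_num)

/-- `C4xF20`-cover `(0; c1:22,c1:4A,c2:4A)` (genus 11, Hurwitz dimension 0; engine `prodwin.py`, exact): the HIDDEN FACTOR `B = V^{H₁×Stab(0)}` of the `(λ⊗ρ)`-piece `P ~ B^{4}` (census row of `P`: `W8.1.1`) — an abelian SURFACE with `(1,1)` `ℚ(√-1)`-action, WEIL TYPE — has literal `det H|_B = -16/5`, `a = 16/5`, `T(a) = []`: row `W2.1.1` (SPLIT); `r₁ = dim_K H¹(C̃/G₂)_λ = 1`. THEOREM S6 (product-window law, census b04.13 (A)) predicts `T(a_B) = []` from `r₁ = 1`, `r_H = 3` — CONFIRMED.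
research route conditional on HC_CM; not a corollary; Q11.4-sentence-2 already refuted in dim ≥ 3. [cite: vanGeemen1994HodgeAV, (5.4.1)] -/
theorem pwC4F20_c122_c14A_c24A_q0_g11_mk_detH_eq_split :
    (QuotientGroup.mk (Units.mk0 (((-16 : ℚ) / 5)) (by norm_num)) : weilNormResidueGroup 1) =
      splitDiscriminantClass 1 1 := by
  have e : Units.mk0 (((-16 : ℚ) / 5)) (by norm_num) = -(Units.mk0 ((16 : ℚ) / 5) (by norm_num)) := Units.ext (by norm_num)
  rw [e, mk_neg_eq_splitDiscriminantClass_iff_of_odd (n := 1) (by decide)]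
  exact mem_normUnitsSubgroup_of_sq_add_mul_sq _ ((8 : ℚ) / 5) ((4 : ℚ) / 5) (by norm_num)

/-- `C4xF20`-cover `(0; c1:4A,c1:5,c2:4B)` (genus 19, Hurwitz dimension 0; engine `prodwin.py`, exact): the HIDDEN FACTOR `B = V^{H₁×Stab(0)}` of the `(λ⊗ρ)`-piece `P ~ B^{4}` (census row of `P`: `W8.1.1`) — an abelian SURFACE with `(1,1)` `ℚ(√-1)`-action, WEIL TYPE — has literal `det H|_B = -8/5`, `a = 8/5`, `T(a) = []`: row `W2.1.1` (SPLIT); `r₁ = dim_K H¹(C̃/G₂)_λ = 1`. THEOREM S6 (product-window law, census b04.13 (A)) predicts `T(a_B) = []` from `r₁ = 1`, `r_H = 3` — CONFIRMED.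
research route conditional on HC_CM; not a corollary; Q11.4-sentence-2 already refuted in dim ≥ 3. [cite: vanGeemen1994HodgeAV, (5.4.1)] -/
theorem pwC4F20_c14A_c15_c24B_q0_g19_mk_detH_eq_split :
    (QuotientGroup.mk (Units.mk0 (((-8 : ℚ) / 5)) (by norm_num)) : weilNormResidueGroup 1) =
      splitDiscriminantClass 1 1 := by
  have e : Units.mk0 (((-8 : ℚ) / 5)) (by norm_num) = -(Units.mk0 ((8 : ℚ) / 5) (by norm_num)) := Units.ext (by norm_num)
  rw [e, mk_neg_eq_splitDiscriminantClass_iff_of_odd (n := 1) (by decide)]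
  exact mem_normUnitsSubgroup_of_sq_add_mul_sq _ ((2 : ℚ) / 5) ((6 : ℚ) / 5) (by norm_num)

/-- `C4xF20`-cover `(0; c0:22,c1:22,c1:4A,c2:4B)` (genus 31, Hurwitz dimension 1; engine `prodwin.py`, exact): the HIDDEN FACTOR `B = V^{H₁×Stab(0)}` of the `(λ⊗ρ)`-piece `P ~ B^{4}` (census row of `P`: `W16.1.1`) — an abelian FOURFOLD with `(2,2)` `ℚ(√-1)`-action, WEIL TYPE — has literal `det H|_B = 1024/5`, `a = 1024/5`, `T(a) = []`: row `W4.1.1` (SPLIT); `r₁ = dim_K H¹(C̃/G₂)_λ = 1`. THEOREM S6 (product-window law, census b04.13 (A)) predicts `T(a_B) = []` from `r₁ = 1`, `r_H = 5` — CONFIRMED.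
research route conditional on HC_CM; not a corollary; Q11.4-sentence-2 already refuted in dim ≥ 3. [cite: vanGeemen1994HodgeAV, (5.4.1)] -/
theorem pwC4F20_c022_c122_c14A_c24B_q0_g31_mk_detH_eq_split :
    (QuotientGroup.mk (Units.mk0 (((1024 : ℚ) / 5)) (by norm_num)) : weilNormResidueGroup 1) =
      splitDiscriminantClass 2 1 := by
  have e : Units.mk0 (((1024 : ℚ) / 5)) (by norm_num) = Units.mk0 ((1024 : ℚ) / 5) (by norm_num) := Units.ext (by norm_num)
  rw [e, mk_eq_splitDiscriminantClass_iff_of_even (n := 2) (by decide)]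
  exact mem_normUnitsSubgroup_of_sq_add_mul_sq _ ((64 : ℚ) / 5) ((32 : ℚ) / 5) (by norm_num)

/-- `F₂₁ × S₃`-cover `(0; 3a:2,3a:2,3a:3)` (genus 22, Hurwitz dimension 0; engine `prodwin.py`, exact): the HIDDEN FACTOR `B = V^{H₁×Stab(0)}` of the `(λ⊗ρ)`-piece `P ~ B^{6}` (census row of `P`: `W12.7.1`) — an abelian SURFACE with `(1,1)` `ℚ(√-7)`-action, WEIL TYPE — has literal `det H|_B = -576`, `a = 576`, `T(a) = []`: row `W2.7.1` (SPLIT); `r₁ = dim_K H¹(C̃/G₂)_λ = 0`.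
research route conditional on HC_CM; not a corollary; Q11.4-sentence-2 already refuted in dim ≥ 3. [cite: vanGeemen1994HodgeAV, (5.4.1)] -/
theorem pwF21S3_3a2_3a2_3a3_q0_g22_mk_detH_eq_split :
    (QuotientGroup.mk (Units.mk0 ((-576 : ℚ)) (by norm_num)) : weilNormResidueGroup 7) =
      splitDiscriminantClass 1 7 := by
  have e : Units.mk0 ((-576 : ℚ)) (by norm_num) = -(Units.mk0 (576 : ℚ) (by norm_num)) := Units.ext (by norm_num)
  rw [e, mk_neg_eq_splitDiscriminantClass_iff_of_odd (n := 1) (by decide)]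
  exact mem_normUnitsSubgroup_of_sq_add_mul_sq _ (24 : ℚ) (0 : ℚ) (by norm_num)

/-- `F₂₁ × S₃`-cover `(0; 3a:2,3a:3,3a:3,e:2)` (genus 43, Hurwitz dimension 1; engine `prodwin.py`, exact): the HIDDEN FACTOR `B = V^{H₁×Stab(0)}` of the `(λ⊗ρ)`-piece `P ~ B^{6}` (census row of `P`: `W24.7.1`) — an abelian FOURFOLD with `(2,2)` `ℚ(√-7)`-action, WEIL TYPE — has literal `det H|_B = 4096/7`, `a = 4096/7`, `T(a) = []`: row `W4.7.1` (SPLIT); `r₁ = dim_K H¹(C̃/G₂)_λ = 0`.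
research route conditional on HC_CM; not a corollary; Q11.4-sentence-2 already refuted in dim ≥ 3. [cite: vanGeemen1994HodgeAV, (5.4.1)] -/
theorem pwF21S3_3a2_3a3_3a3_e2_q0_g43_mk_detH_eq_split :
    (QuotientGroup.mk (Units.mk0 (((4096 : ℚ) / 7)) (by norm_num)) : weilNormResidueGroup 7) =
      splitDiscriminantClass 2 7 := by
  have e : Units.mk0 (((4096 : ℚ) / 7)) (by norm_num) = Units.mk0 ((4096 : ℚ) / 7) (by norm_num) := Units.ext (by norm_num)
  rw [e, mk_eq_splitDiscriminantClass_iff_of_even (n := 2) (by decide)]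
  exact mem_normUnitsSubgroup_of_sq_add_mul_sq _ (0 : ℚ) ((64 : ℚ) / 7) (by norm_num)

/-- `F₂₁ × S₃`-cover `(0; 3a:2,3a:2,3a:2,e:2)` (genus 64, Hurwitz dimension 1; engine `prodwin.py`, exact): the HIDDEN FACTOR `B = V^{H₁×Stab(0)}` of the `(λ⊗ρ)`-piece `P ~ B^{6}` (census row of `P`: `W36.7.1`) — an abelian SIXFOLD with `(3,3)` `ℚ(√-7)`-action, WEIL TYPE — has literal `det H|_B = -331776`, `a = 331776`, `T(a) = []`: row `W6.7.1` (SPLIT); `r₁ = dim_K H¹(C̃/G₂)_λ = 0`.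
research route conditional on HC_CM; not a corollary; Q11.4-sentence-2 already refuted in dim ≥ 3. [cite: vanGeemen1994HodgeAV, (5.4.1)] -/
theorem pwF21S3_3a2_3a2_3a2_e2_q0_g64_mk_detH_eq_split :
    (QuotientGroup.mk (Units.mk0 ((-331776 : ℚ)) (by norm_num)) : weilNormResidueGroup 7) =
      splitDiscriminantClass 3 7 := by
  have e : Units.mk0 ((-331776 : ℚ)) (by norm_num) = -(Units.mk0 (331776 : ℚ) (by norm_num)) := Units.ext (by norm_num)
  rw [e, mk_neg_eq_splitDiscriminantClass_iff_of_odd (n := 3) (by decide)]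
  exact mem_normUnitsSubgroup_of_sq_add_mul_sq _ (576 : ℚ) (0 : ℚ) (by norm_num)

/-- `F₂₁ × S₃`-cover `(0; 3a:3,3a:3,3a:e,e:2,e:2)` (genus 64, Hurwitz dimension 2; engine `prodwin.py`, exact): the HIDDEN FACTOR `B = V^{H₁×Stab(0)}` of the `(λ⊗ρ)`-piece `P ~ B^{6}` (census row of `P`: `W36.7.1`) — an abelian SIXFOLD with `(3,3)` `ℚ(√-7)`-action, WEIL TYPE — has literal `det H|_B = -93312/7`, `a = 93312/7`, `T(a) = []`: row `W6.7.1` (SPLIT); `r₁ = dim_K H¹(C̃/G₂)_λ = 0`.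
research route conditional on HC_CM; not a corollary; Q11.4-sentence-2 already refuted in dim ≥ 3. [cite: vanGeemen1994HodgeAV, (5.4.1)] -/
theorem pwF21S3_3a3_3a3_3ae_e2_e2_q0_g64_mk_detH_eq_split :
    (QuotientGroup.mk (Units.mk0 (((-93312 : ℚ) / 7)) (by norm_num)) : weilNormResidueGroup 7) =
      splitDiscriminantClass 3 7 := by
  have e : Units.mk0 (((-93312 : ℚ) / 7)) (by norm_num) = -(Units.mk0 ((93312 : ℚ) / 7) (by norm_num)) := Units.ext (by norm_num)
  rw [e, mk_neg_eq_splitDiscriminantClass_iff_of_odd (n := 3) (by decide)]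
  exact mem_normUnitsSubgroup_of_sq_add_mul_sq _ (-108 : ℚ) ((108 : ℚ) / 7) (by norm_num)

end Summit.HodgeConjecture.HodgeConjecture.Ring2.WeilCoverage
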